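import Mathlib
import HarnessLib
import Literature.NumberTheory.Automorphic.ArthurClozelWeakLiftingIsobaric

/-!
# Stub `stub_card_le_one_of_isobaricWeakLift_members` of line Sketch (crux stmt-Langlands-16812
`ParityBlindBianchi.QuadraticBaseChangeGL2`) — the `L`-function step of Arthur–Clozel Thm. 4.2 (a)
with MEMBER-INDEXED Jacquet–Shalika inputs

Helper file (`--supports stmt-Langlands-16812`).  The tree's `card_le_one_of_isobaricWeakLift`
(`Literature/NumberTheory/Automorphic/ArthurClozelWeakLiftingIsobaric.lean`) takes the Jacquet–Shalika
facts (2.2) (three renderings), (2.3) and multiplicity one over `E` in ALL ranks `a b : ℕ`, although its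
proof applies them only at the member ranks `d m`, `(d m, d m')` of the isobaric datum.  This file is the
same theorem and the same proof with those five hypotheses indexed by the MEMBERS `m m' : M` instead of by
all ranks — so that at `n = 2`, where the member ranks are `(1,1)` or `(2,2)` only, the caller can feed the
proved rank-`1` / rank-`≤ 2` instances of the tree (`JacquetShalika1981_partialPairL_pole_of_eq_conj_holds_of_le_two`,
`…_boundary_of_ne_one_one`, `…_at_one_of_ne_conj_one`, `multiplicity_one_gl_of_le_one`) and keep as named
inputs only the rank-`2` facts.  Proof body byte-identical to the tree's except for the five application
sites (`h22cE m'`, `h23E m'`, `hm1E m'`, `h22aE m m'`, `h22bE m m'`).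

No definitions, no named facts.
-/

noncomputable section

open scoped MatrixGroups Topology NumberField
open NumberField IsDedekindDomain MeasureTheory Filter Literature.NumberTheory.Automorphic
  Literature.NumberTheory.Automorphic.AdelicGroupData
open Literature.NumberTheory.GaloisRepresentations (HeckeCharacter finite_setOf_not_isUnramifiedIn
  ramificationIdxIn_eq_one_of_isUnramifiedIn)

-- `Summit.Langlands.Langlands.…`: summit = sub-problem name (D-0017 nested layout), not a typo.
set_option linter.dupNamespace false

namespace Summit.Langlands.Langlands.Theorems.QuadraticBaseChangeGL2

/-- **The `L`-function step of the proof of Arthur–Clozel Ch. 3 Thm. 4.2 (a) (pp. 204–205), member-indexed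
form: an isobaric weak-lift datum over `E` for a cuspidal `π` with `π ⊗ η ≠ π` has at most one member.**
Verbatim `card_le_one_of_isobaricWeakLift` of the tree (setting, proof and notation: see its docstring —
Lemma 4.3 pairing of the datum with its conjugate, poles at `p = 1 - 2 re s_{m₀}` and at `s = 1`), except
that the Jacquet–Shalika inputs over `E` — (2.2) `h22aE`, `h22bE`, `h22cE`, (2.3) `h23E` — and multiplicity
one `hm1E` are assumed only at the member ranks: for all members `m m' : M` at `(d m, d m')`, resp. `d m`.
The `F`-side inputs are at rank `n` as there.
[cite: ArthurClozelAMS120, Ch. 3, Thm. 4.2 (a), proof, pp. 204–205] -/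
theorem stub_card_le_one_of_isobaricWeakLift_members (n : ℕ) {F E : Type} [Field F] [NumberField F]
    [Field E] [NumberField E] [Algebra F E] [IsGalois F E] (hℓ : (Module.finrank F E).Prime)
    (νE : (a : ℕ) → Measure (gl a E).automorphicQuotient)
    [hνE : ∀ a, (gl a E).IsAutomorphicMeasure (νE a)]
    {μ : Measure (gl n F).automorphicQuotient} [(gl n F).IsAutomorphicMeasure μ]
    (h22aF : @JacquetShalika1981_partialPairL_boundary_of_ne_one n n F _ _ μ _ μ _)
    (h22cF : @JacquetShalika1981_partialPairL_at_one_of_ne_conj n F _ _ μ _)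
    (h23F : @JacquetShalika1981_partialPairL_pole_of_eq_conj n F _ _ μ _)
    (hm1F : multiplicity_one_gl n F μ) (hn : 0 < n) (P : CuspidalAutomorphicRepGL n F μ)
    {η : HeckeCharacter F} (hη : η.IsClassFieldCharacter E)
    (hP : P.twistByFiniteOrderChar η hη.isFiniteOrder ≠ P)
    {𝔪 : Ideal (𝓞 F)} (h𝔪 : 𝔪 ≠ 0)
    (hη𝔪 : ∀ k ∈ principalCongruenceLevel n F 𝔪, η (Matrix.GeneralLinearGroup.det k) = 1)
    {S : Set (HeightOneSpectrum (𝓞 F))} (hS : S.Finite) (h𝔪S : ∀ v ∉ S, ¬ v.asIdeal ∣ 𝔪)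
    (hunrS : ∀ v ∉ S, Algebra.IsUnramifiedIn (𝓞 E) v.asIdeal)
    {α : SatakeFamily F} (hα : IsSatakeFamilyOf P S α)
    {M : Type} [Fintype M] (d : M → ℕ) (hd : ∀ m, 0 < d m)
    (Q : ∀ m, CuspidalAutomorphicRepGL (d m) E (νE (d m)))
    (h22aE : ∀ m m' : M, @JacquetShalika1981_partialPairL_boundary_of_ne_one (d m) (d m') E _ _ (νE (d m)) _ (νE (d m')) _)
    (h22bE : ∀ m m' : M, @JacquetShalika1981_partialPairL_at_one_of_rank_ne (d m) (d m') E _ _ (νE (d m)) _ (νE (d m')) _)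
    (h22cE : ∀ m : M, @JacquetShalika1981_partialPairL_at_one_of_ne_conj (d m) E _ _ (νE (d m)) _)
    (h23E : ∀ m : M, @JacquetShalika1981_partialPairL_pole_of_eq_conj (d m) E _ _ (νE (d m)) _)
    (hm1E : ∀ m : M, multiplicity_one_gl (d m) E (νE (d m)))
    (s : M → ℂ) (m₀ : M) (hm₀ : ∀ m, (s m₀).re ≤ (s m).re) (hds : ∑ m, (d m : ℂ) * s m = 0)
    {A : M → SatakeFamily E} (hA : ∀ m, IsSatakeFamilyOf (Q m) {w | w.under (𝓞 F) ∈ S} (A m))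
    (hrel : ∀ w : HeightOneSpectrum (𝓞 E), w.under (𝓞 F) ∉ S →
      (α (w.under (𝓞 F))).map (· ^ w.asIdeal.inertiaDeg (𝓞 F)) =
        ∑ m, (A m w).map (((w.residueCard : ℂ) ^ (-(s m))) * ·)) :
    Fintype.card M ≤ 1 := by
  -- adapted from Literature/NumberTheory/Automorphic/ArthurClozelWeakLiftingIsobaric.lean
  -- (card_le_one_of_isobaricWeakLift), member-indexed at five application sites
  classical
  -- notation and elementary data
  set ℓ : ℕ := Module.finrank F E with hℓdef
  have hℓpos : 0 < ℓ := hℓ.pos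
  haveI : FiniteDimensional F E := Module.finite_of_finrank_pos hℓpos
  -- the real parts of the shifts: `re s_{m₀} ≤ 0`, with equality only if all vanish
  have hsumre : ∑ m, (d m : ℝ) * (s m).re = 0 := by
    have h0 : (∑ m, (d m : ℂ) * s m).re = 0 := by rw [hds, Complex.zero_re]
    rw [Complex.re_sum] at h0
    simpa only [Complex.mul_re, Complex.natCast_re, Complex.natCast_im, zero_mul, sub_zero]
      using h0
  have hre : (s m₀).re ≤ 0 := by
    by_contra hpos
    push Not at hpos
    have h1 : 0 < ∑ m, (d m : ℝ) * (s m).re := by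
      refine Finset.sum_pos (fun m _ => ?_) ⟨m₀, Finset.mem_univ _⟩
      have h2 := hm₀ m
      have hdi : (0 : ℝ) < d m := Nat.cast_pos.mpr (hd m)
      nlinarith
    linarith
  have hre0 : (s m₀).re = 0 → ∀ m, (s m).re = 0 := by
    intro h0 m
    have hnn : ∀ i ∈ (Finset.univ : Finset M), 0 ≤ (d i : ℝ) * (s i).re := fun i _ =>
      mul_nonneg (Nat.cast_nonneg _) (by rw [← h0]; exact hm₀ i)
    have h1 := (Finset.sum_eq_zero_iff_of_nonneg hnn).mp hsumre m (Finset.mem_univ m)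
    rcases mul_eq_zero.mp h1 with h | h
    · exact absurd h (Nat.cast_ne_zero.mpr (hd m).ne')
    · exact h
  -- the character `η`
  have hηfo : η.IsFiniteOrder := hη.isFiniteOrder
  have hηu : η.IsUnitary := hηfo.isUnitary
  have hη₀ : ∀ t, η (posRealIdele F t) = 1 := fun t =>
    HeckeCharacter.map_posRealIdele_of_isFiniteOrder hηfo t
  have hηpow : ∀ j : ℕ, (η ^ j).IsUnitary := fun j => hηu.pow j
  have hηpow₀ : ∀ (j : ℕ) (t), (η ^ j) (posRealIdele F t) = 1 := fun j t => by
    rw [HeckeCharacter.pow_apply, hη₀ t, one_pow]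
  have hord : orderOf η = ℓ :=
    IsClassFieldCharacter.orderOf_eq_finrank exists_isClassFieldCharacter_holds hℓ hη
  have hζS : ∀ v ∉ S, IsPrimitiveRoot (η.valueAtUniformizer v) (v.asIdeal.inertiaDegIn (𝓞 E)) :=
    fun v hv => hη.isPrimitiveRoot_valueAtUniformizer hℓ
      (ramificationIdxIn_eq_one_of_isUnramifiedIn (hunrS v hv))
  have hfg : ∀ v ∉ S, v.asIdeal.inertiaDegIn (𝓞 E) *
      Nat.card {w : HeightOneSpectrum (𝓞 E) // w.under (𝓞 F) = v} = ℓ := fun v hv => by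
    rw [mul_comm]
    exact card_placesOver_mul_inertiaDegIn v
      (ramificationIdxIn_eq_one_of_isUnramifiedIn (hunrS v hv))
  -- `ζ_v = \overline{η(ϖ_v)}`, again a primitive `f_v`-th root of unity
  set ζ : HeightOneSpectrum (𝓞 F) → ℂ := fun v => starRingEnd ℂ (η.valueAtUniformizer v)
    with hζdef
  have hζ : ∀ v ∉ S, IsPrimitiveRoot (ζ v) (v.asIdeal.inertiaDegIn (𝓞 E)) := fun v hv =>
    (hζS v hv).map_of_injective (RingHom.injective (starRingEnd ℂ))
  -- the twists `\overline{π ⊗ ηʲ}` and their Satake families `\bar η(ϖ)ʲ ᾱ`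
  set P' : ℕ → CuspidalAutomorphicRepGL n F μ := fun j =>
    (P.twistByChar (η ^ j) (hηpow j) (hηpow₀ j)).conj with hP'def
  set β : ℕ → SatakeFamily F := fun j v =>
    ((α v).map (starRingEnd ℂ)).map (ζ v ^ j * ·) with hβdef
  have hβ : ∀ j, IsSatakeFamilyOf (P' j) S (β j) := by
    intro j
    have key := (hα.twistByChar (η ^ j) (hηpow j) (hηpow₀ j) h𝔪
      (fun k hk => by rw [HeckeCharacter.pow_apply, hη𝔪 k hk, one_pow]) h𝔪S).conj
    refine key.congr fun v _ => ?_
    simp only [hβdef, hζdef]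
    rw [HeckeCharacter.valueAtUniformizer_pow, map_conj_map_const_mul]
  have hP'j : ∀ j, j ≠ 0 → j < ℓ → P ≠ (P' j).conj := by
    intro j hj0 hjℓ h
    have hne := CuspidalAutomorphicRepGL.twistByFiniteOrderChar_pow_ne_self hn hm1F h22cF h23F P
      hηfo (by rw [hord]; exact hℓ) hP hj0 (by rw [hord]; exact hjℓ)
    refine hne ?_
    calc P.twistByFiniteOrderChar (η ^ j) (isFiniteOrder_pow hηfo j) = (P' j).conj := by
          simp only [hP'def, CuspidalAutomorphicRepGL.conj_conj]
          rfl
      _ = P := h.symm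
  -- families over `E`: the datum `D`, its conjugate `D₂`, the conjugate member families `Ab`
  set c : M → HeightOneSpectrum (𝓞 E) → ℂ := fun m w => (w.residueCard : ℂ) ^ (-(s m))
    with hcdef
  set c₂ : M → HeightOneSpectrum (𝓞 E) → ℂ := fun m w =>
    (w.residueCard : ℂ) ^ (-(starRingEnd ℂ (s m))) with hc₂def
  set Ab : M → SatakeFamily E := fun m w => (A m w).map (starRingEnd ℂ) with hAbdef
  have hAb : ∀ m, IsSatakeFamilyOf (Q m).conj {w | w.under (𝓞 F) ∈ S} (Ab m) := fun m =>
    (hA m).conj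
  set D : SatakeFamily E := fun w => ∑ m, (A m w).map (c m w * ·) with hDdef
  set D₂ : SatakeFamily E := fun w => ∑ m, (Ab m w).map (c₂ m w * ·) with hD₂def
  have hcconj : ∀ m w, starRingEnd ℂ (c m w) = c₂ m w := fun m w => by
    simp only [hcdef, hc₂def, conj_natCast_cpow, map_neg]
  have hDconj : ∀ w, (D w).map (starRingEnd ℂ) = D₂ w := by
    intro w
    have h1 := map_sum (Multiset.mapAddMonoidHom (starRingEnd ℂ))
      (fun m => (A m w).map (c m w * ·)) Finset.univ
    simp only [Multiset.coe_mapAddMonoidHom] at h1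
    simp only [hDdef, hD₂def, hAbdef]
    rw [h1]
    exact Finset.sum_congr rfl fun m _ => by rw [map_const_mul_map_conj, hcconj]
  have hSE : {w : HeightOneSpectrum (𝓞 E) | w.under (𝓞 F) ∈ S}.Finite := finite_setOf_under_mem hS
  have hDrel : ∀ w : HeightOneSpectrum (𝓞 E), w.under (𝓞 F) ∉ S →
      D w = (α (w.under (𝓞 F))).map (· ^ (w.under (𝓞 F)).asIdeal.inertiaDegIn (𝓞 E)) := by
    intro w hw
    simp only [hDdef, hcdef]
    rw [← hrel w hw, inertiaDeg_eq_inertiaDegIn_under w]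
  have hD₂rel : ∀ w : HeightOneSpectrum (𝓞 E), w.under (𝓞 F) ∉ S →
      D₂ w = ((α (w.under (𝓞 F))).map (starRingEnd ℂ)).map
        (· ^ (w.under (𝓞 F)).asIdeal.inertiaDegIn (𝓞 E)) := by
    intro w hw
    rw [← hDconj w, hDrel w hw, map_conj_map_pow]
  -- local factors: multiplicativity in both families and the shifts
  have hq0 : ∀ w : HeightOneSpectrum (𝓞 E), (w.residueCard : ℕ) ≠ 0 := fun w => by
    have := w.one_lt_residueCard
    omega
  set t : M × M → ℂ := fun p => s p.1 + starRingEnd ℂ (s p.2) with htdef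
  have htre : ∀ p, (t p).re = (s p.1).re + (s p.2).re := fun p => by
    simp only [htdef, Complex.add_re, Complex.conj_re]
  set T : Finset (M × M) := Finset.univ ×ˢ Finset.univ with hTdef
  have hmemT : ∀ p, p ∈ T := fun p => by
    simp only [hTdef, Finset.mem_product, Finset.mem_univ, and_self]
  have hfacE : ∀ (w : HeightOneSpectrum (𝓞 E)) (s' : ℂ),
      ((satakePairPolynomial (D w) (D₂ w)).eval ((w.residueCard : ℂ) ^ (-s')))⁻¹ =
        ∏ p ∈ T, ((satakePairPolynomial (A p.1 w) (Ab p.2 w)).eval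
          ((w.residueCard : ℂ) ^ (-(s' + t p))))⁻¹ := by
    intro w s'
    simp only [hDdef, hD₂def, hTdef]
    rw [satakePairPolynomial_sum_sum, Polynomial.eval_prod, Finset.prod_inv_distrib]
    congr 1
    refine Finset.prod_congr rfl fun p _ => ?_
    have hexp : s' + starRingEnd ℂ (s p.2) + s p.1 = s' + t p := by
      simp only [htdef]
      ring
    rw [eval_satakePairPolynomial_map_const_mul, satakePairPolynomial_comm,
      eval_satakePairPolynomial_map_const_mul, satakePairPolynomial_comm, hcdef, hc₂def,
      natCast_cpow_neg_mul_cpow_neg _ (hq0 w), natCast_cpow_neg_mul_cpow_neg _ (hq0 w), hexp]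
  -- the region `re s > r = 1 - 2 re s_{m₀}` (`r ≥ 1`) and convergence there
  set r : ℝ := 1 - 2 * (s m₀).re with hrdef
  have hr1 : 1 ≤ r := by rw [hrdef]; linarith
  have hRt : ∀ (p : M × M) (s' : ℂ), r < s'.re → 1 < (s' + t p).re := fun p s' hs' => by
    have h1 := hm₀ p.1
    have h2 := hm₀ p.2
    rw [Complex.add_re, htre]
    rw [hrdef] at hs'
    linarith
  have hR1 : ∀ s' : ℂ, r < s'.re → 1 < s'.re := fun s' hs' => lt_of_le_of_lt hr1 hs'
  have hE21 : ∀ {s' : ℂ}, r < s'.re → ∀ p ∈ T,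
      Multipliable fun w : {w : HeightOneSpectrum (𝓞 E) //
          w ∉ {w' : HeightOneSpectrum (𝓞 E) | w'.under (𝓞 F) ∈ S}} =>
        ((satakePairPolynomial (A p.1 w.1) (Ab p.2 w.1)).eval
          ((w.1.residueCard : ℂ) ^ (-(s' + t p))))⁻¹ := fun hs' p _ =>
    JacquetShalika1981_multipliable_partialPairL_holds (n := d p.1) (m := d p.2) (K := E)
      (μ := νE (d p.1)) (μ' := νE (d p.2)) (Q p.1) (Q p.2).conj (hA p.1) (hAb p.2) (hRt p _ hs')
  have hF21 : ∀ {s' : ℂ}, r < s'.re → ∀ j ∈ Finset.range ℓ,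
      Multipliable fun v : {v : HeightOneSpectrum (𝓞 F) // v ∉ S} =>
        ((satakePairPolynomial (α v.1) (β j v.1)).eval
          ((v.1.residueCard : ℂ) ^ (-s')))⁻¹ := fun hs' j _ =>
    JacquetShalika1981_multipliable_partialPairL_holds (n := n) (m := n) (K := F)
      (μ := μ) (μ' := μ) P (P' j) hα (hβ j) (hR1 _ hs')
  -- the two sides
  set LE : M × M → ℂ → ℂ := fun p s' =>
    partialPairL {w : HeightOneSpectrum (𝓞 E) | w.under (𝓞 F) ∈ S} (A p.1) (Ab p.2) (s' + t p)
    with hLEdef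
  set LF : ℕ → ℂ → ℂ := fun j s' => partialPairL S α (β j) s' with hLFdef
  -- Lemma 4.3 and the splitting of both sides: the identity on `re s > r`
  have hident : ∀ s' : ℂ, r < s'.re → ∏ p ∈ T, LE p s' = ∏ j ∈ Finset.range ℓ, LF j s' := by
    intro s' hs'
    have hL : ∏ p ∈ T, LE p s' =
        partialPairL {w : HeightOneSpectrum (𝓞 E) | w.under (𝓞 F) ∈ S} D D₂ s' := by
      simp only [hLEdef, partialPairL]
      rw [← Multipliable.tprod_finsetProd (hE21 hs')]
      exact tprod_congr fun w => (hfacE w.1 _).symm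
    have h43 : partialPairL {w : HeightOneSpectrum (𝓞 E) | w.under (𝓞 F) ∈ S} D D₂ s' =
        ∏ j ∈ Finset.range ℓ, partialPairL S α (β j) s' := by
      refine partialPairL_weakBaseChange_eq_prod S hℓpos
        (fun v => v.asIdeal.inertiaDegIn (𝓞 E))
        (fun v => Nat.card {w : HeightOneSpectrum (𝓞 E) // w.under (𝓞 F) = v}) ζ
        hfg hζ (fun w _ => inertiaDeg_eq_inertiaDegIn_under w) (fun v _ => rfl)
        α (fun v => (α v).map (starRingEnd ℂ)) D D₂ hDrel hD₂rel ?_ ?_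
      · exact (multipliable_prod (hE21 hs')).congr fun w => (hfacE w.1 _).symm
      · intro j hj
        exact hF21 hs' j hj
    rw [hL, h43]
  -- the point `p = 1 - 2 re s_{m₀}` and the filter `s → p`, `re s > r`
  set pt : ℂ := (r : ℂ) with hptdef
  have hptre : pt.re = r := by rw [hptdef, Complex.ofReal_re]
  set l : Filter ℂ := 𝓝[{s' : ℂ | r < s'.re}] pt with hldef
  haveI hlne : l.NeBot := by
    have h := nhdsWithin_setOf_lt_re_neBot pt
    rwa [hptre] at h
  have hsub : Tendsto (fun s' : ℂ => s' - pt) l (𝓝 0) := tendsto_sub_nhdsWithin pt _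
  have hl1 : l ≤ 𝓝[{s' : ℂ | 1 < s'.re}] pt := nhdsWithin_mono pt fun s' hs' => hR1 s' hs'
  -- each factor on the left: a finite non-zero limit or a pole; the diagonal ones poles
  have hlimE : ∀ p ∈ T, ∃ (e : ℕ) (c₀ : ℂ), c₀ ≠ 0 ∧
      Tendsto (fun s' => (s' - pt) ^ e * LE p s') l (𝓝 c₀) ∧
      (p.1 = p.2 → (s p.1).re = (s m₀).re → e = 1) := by
    rintro ⟨m, m'⟩ -
    have h1 := hm₀ m
    have h2 := hm₀ m'
    have hzre : 1 ≤ (pt + t (m, m')).re := by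
      rw [Complex.add_re, hptre, htre, hrdef]
      linarith
    have hshift : Tendsto (fun s' : ℂ => s' + t (m, m')) l
        (𝓝[{s' : ℂ | 1 < s'.re}] (pt + t (m, m'))) :=
      tendsto_add_const_nhdsWithin_lt_re (by rw [htre, hrdef]; linarith)
    by_cases hcase : pt + t (m, m') = 1 ∧ d m = d m'
    · -- same point `1` and same rank: (2.2)/(2.3) inside one `L²_cusp`
      obtain ⟨hz1, hdd⟩ := hcase
      obtain ⟨c₀, hc₀, hlim⟩ := tendsto_partialPairL_at_one (h22cE m') (h23E m')
        (hm1E m') (hd m') (hdd ▸ Q m) (Q m').conj hSE (isSatakeFamilyOf_cast νE hdd (Q m) (hA m))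
        (hAb m')
      rw [hz1] at hshift
      refine ⟨if (hdd ▸ Q m : CuspidalAutomorphicRepGL (d m') E (νE (d m'))) = (Q m').conj.conj
          then 1 else 0, c₀, hc₀, (hlim.comp hshift).congr fun s' => ?_, ?_⟩
      · simp only [Function.comp_apply, hLEdef]
        rw [show s' + t (m, m') - 1 = s' - pt by rw [← hz1]; ring]
      · rintro (rfl : m = m') -
        rw [if_pos]
        change Q m = (Q m).conj.conj
        exact (Q m).conj_conj.symm
    · have hne : pt + t (m, m') ≠ 1 ∨ d m ≠ d m' := by
        by_contra h
        push Not at h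
        exact hcase h
      obtain ⟨c₀, hc₀, hlim⟩ := tendsto_partialPairL_of_ne_one_or_rank_ne (h22aE m m')
        (h22bE m m') (hd m) (hd m') (Q m) (Q m').conj hSE (hA m) (hAb m') hzre hne
      refine ⟨0, c₀, hc₀, (hlim.comp hshift).congr fun s' => ?_, ?_⟩
      · simp only [Function.comp_apply, hLEdef, pow_zero, one_mul]
      · rintro (rfl : m = m') hre'
        exfalso
        refine hne.elim (fun h => h ?_) (fun h => h rfl)
        change (r : ℂ) + (s m + starRingEnd ℂ (s m)) = 1
        rw [Complex.add_conj, hrdef, hre']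
        push_cast
        ring
  choose! e cE hcE0 hcE he using hlimE
  have hLHS := tendsto_pow_mul_finsetProd T (fun p hp => hcE p hp)
  have hcEne : (∏ p ∈ T, cE p) ≠ 0 := Finset.prod_ne_zero_iff.mpr fun p hp => hcE0 p hp
  have hNpos : (∑ p ∈ T, e p) ≠ 0 := by
    intro h0
    have h1 := Finset.sum_eq_zero_iff.mp h0 (m₀, m₀) (hmemT _)
    rw [he (m₀, m₀) (hmemT _) rfl rfl] at h1
    exact one_ne_zero h1
  have hev : (fun s' => ∏ p ∈ T, LE p s') =ᶠ[l] fun s' => ∏ j ∈ Finset.range ℓ, LF j s' := by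
    filter_upwards [self_mem_nhdsWithin] with s' hs' using hident s' hs'
  -- case analysis on `re s_{m₀}`
  rcases hre.lt_or_eq with hlt | heq
  · -- `re s_{m₀} < 0`: the point `p` has `re p > 1`, where the right side is finite
    exfalso
    have hpt1 : pt ≠ 1 := by
      intro h
      have := congrArg Complex.re h
      rw [hptre, Complex.one_re, hrdef] at this
      linarith
    have hzF : 1 ≤ pt.re := by rw [hptre]; exact hr1
    have hlimF : ∀ j ∈ Finset.range ℓ, ∃ c₀ : ℂ, Tendsto (LF j) l (𝓝 c₀) := by
      intro j _
      obtain ⟨c₀, -, hc₀⟩ := tendsto_partialPairL_of_ne_one_or_rank_ne h22aF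
        (fun h => absurd rfl h) hn hn P (P' j) hS hα (hβ j) hzF (Or.inl hpt1)
      exact ⟨c₀, hc₀.mono_left hl1⟩
    choose! cF hcF using hlimF
    have hRHS : Tendsto (fun s' => ∏ j ∈ Finset.range ℓ, LF j s') l
        (𝓝 (∏ j ∈ Finset.range ℓ, cF j)) :=
      tendsto_finsetProd _ fun j hj => hcF j hj
    exact false_of_pole_of_tendsto hsub hev hNpos hcEne hLHS hRHS
  · -- all `re sₘ = 0`: pole orders at `s = 1`
    have hall : ∀ m, (s m).re = 0 := hre0 heq
    have hr' : r = 1 := by rw [hrdef, heq]; ring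
    have hpt' : pt = 1 := by rw [hptdef, hr', Complex.ofReal_one]
    have hl' : l = 𝓝[{s' : ℂ | 1 < s'.re}] 1 := by
      rw [hldef, hpt']
      simp only [hr']
    -- right side: `(s-1)^{e_j} L_j → c_j ≠ 0` with `e_j = [π = π ⊗ ηʲ]`, `∑ e_j ≤ 1`
    have hlimF : ∀ j ∈ Finset.range ℓ, ∃ c₀ : ℂ, c₀ ≠ 0 ∧
        Tendsto (fun s' => (s' - pt) ^ (if P = (P' j).conj then 1 else 0) * LF j s') l
          (𝓝 c₀) := by
      intro j _
      obtain ⟨c₀, hc₀, hlim⟩ := tendsto_partialPairL_at_one h22cF h23F hm1F hn P (P' j) hS hα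
        (hβ j)
      refine ⟨c₀, hc₀, ?_⟩
      rw [hl', hpt']
      exact hlim
    choose! cF hcF0 hcF using hlimF
    have hRHS := tendsto_pow_mul_finsetProd (Finset.range ℓ) (fun j hj => hcF j hj)
    have hNF : (∑ j ∈ Finset.range ℓ, (if P = (P' j).conj then 1 else 0)) ≤ 1 := by
      rw [Finset.sum_eq_single_of_mem 0 (Finset.mem_range.mpr hℓpos) ?_]
      · split_ifs <;> simp
      · intro j hj hj0
        rw [if_neg (hP'j j hj0 (Finset.mem_range.mp hj))]
    -- left side: at least the diagonal poles
    have hNE : Fintype.card M ≤ ∑ p ∈ T, e p := by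
      have hone : ∀ m, e (m, m) = 1 := fun m =>
        he (m, m) (hmemT _) rfl (by change (s m).re = (s m₀).re; rw [hall m, heq])
      have hsub' : (Finset.univ.image fun m : M => (m, m)) ⊆ T := fun p _ => hmemT p
      have hdiag := Finset.sum_le_sum_of_subset (f := e) hsub'
      rw [Finset.sum_image (fun m _ m' _ h => (Prod.mk.inj h).1)] at hdiag
      calc Fintype.card M = ∑ _m : M, 1 := by simp
        _ = ∑ m, e (m, m) := Finset.sum_congr rfl fun m _ => (hone m).symm
        _ ≤ ∑ p ∈ T, e p := hdiag
    have hle := pole_order_le_of_tendsto_of_eventuallyEq hsub hev hcEne hLHS hRHS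
    exact hNE.trans (hle.trans hNF)

end Summit.Langlands.Langlands.Theorems.QuadraticBaseChangeGL2

end
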